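import Literature.NumberTheory.EllipticCurves.BigGaloisRepSelmer
import Summits.BirchSwinnertonDyer.BirchSwinnertonDyer.Theorems.ErratumRoadFiveBigRepLocalInvariants
import Literature.Algebra.Module.EigenvectorAnnihilatorCountProofs
import Mathlib.RingTheory.QuotSMulTop
import Mathlib.GroupTheory.QuotientGroup.Finite
import Mathlib.NumberTheory.Padics.RingHoms
import HarnessLib

/-!
# Crux 4 `BSDpOnCellC` (stmt-BirchSwinnertonDyer-19034), line `telescope`, leaves N2 `stub_weightTwoControl` / N3
# `stub_memberControl`: THE GLOBAL CONTROL DEFECT IS FINITE — the `hglob`/`hfin` binder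
# `Finite (M₂^{Γ_K} ⧸ (C c) • M₂^{Γ_K})` of `TelescopeK2WeightControl.finite_ker_torsionInclH1_of_finite_quot` /
# `twoSided_finite_control` (p737740) for the big module `M₂ = A ⊗ Λ^*(Ψ⁻¹) = bigRep κ ρ`, from the finiteness of the
# `ker κ`-fixed `c`-torsion of `A` (helper, `--supports stmt-BirchSwinnertonDyer-19034 --as helper`; closes nothing)

Cell `bsd-eis`, width seat `bsd-line-x2-p2` (prover g19, 2026-08-29; D-0154 KEY row 5). THEOREMS ONLY: no definition, no named
fact, no `sorry`, no instance, no notation. Serves ideator bsd-idea-12 g36's sub-leaf W2 `stub_weightTwoControlMap` (memo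
`Cruxes/BSDpOnCellC/W-PRICING-n2.md` rev 1.3 §W2 (m2)(glob): «`Finite (M₂^{Γ_K} ⧸ π • ⊤)` — `M₂^{Γ_K} = A₂(K_∞)` (Shapiro for `H⁰` of
the co-induced module; … the `H⁰` statement for a general `ρ₂` is NOT in the tree) and `A₂(K_∞)[X] = A₂[X](K_∞) ≈ E(K_∞)[p^∞]` finite
via (fd₀)») of the registered leaf N2, AND the same binder of N3 at the member weights (`c = X − x_k`).

## What is proved (unconditional; binders only; general coefficient ring `𝒪`, general group `G`)

§1 PURE ALGEBRA (any commutative ring `R`, module `M`, `x ∈ R`): `finite_of_pow_smul_eq_zero` (a module killed by `x ^ n` with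
finite `M[x]` is finite: induction along `0 → M[x] → M → xM → 0`); `natCard_quotSMulTop_eq_natCard_torsionBy` (FINITE `M`:
`#(M ⧸ xM) = #M[x]`); **`finite_quotSMulTop_of_isPowTorsion` / `natCard_quotSMulTop_le_of_isPowTorsion`** — an `x`-POWER-TORSION
module with finite `x`-torsion has finite `x`-cotorsion, `#(M ⧸ xM) ≤ #M[x]` (a finitely generated submodule `N` is finite, the
classes of its elements are images of `N ⧸ xN`, `#(N ⧸ xN) = #N[x] ≤ #M[x]`; an infinite `M ⧸ xM` would hold `#M[x] + 1` classes).

§2 THE CO-INDUCED MODULE `M = bigRep κ ρ` (smooth `p`-primary `Φ : ℤ_p → A`, `(g·Φ)(x) = ρ(g)(Φ(x − κ g))`, `C c` acting on values):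
`exists_C_pow_smul_eq_zero` (every `Φ` is `(C c)`-power torsion if the `p`-primary elements of `A` are: finitely many values);
`exists_injective_torsionBy_invariants` / `finite_torsionBy_invariants` (for `κ(G) ⊇ p^s ℤ_p`, `Φ ↦ (Φ(i))_{i<p^s}` embeds `M^G[C c]`
into `{a ∈ A | c • a = 0, a fixed by ker κ}^{p^s}` — tree `BigRepLocalInvariants.eq_of_forall_apply_natCast_eq`);
**`finite_quotSMulTop_invariants`** / `natCard_quotSMulTop_invariants_le` — THE BINDER: `M^G ⧸ (C c) • M^G` is finite, of order
`≤ #{a ∈ A[c] | a fixed by ker κ}^{p^s}`; **`finite_quotSMulTop_invariants_anticyclotomic`** — `s = 0` for `AnticyclotomicBigGaloisRep κ ρ`,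
`κ : ZpExtension K p` onto: literally the `hglob` of `TelescopeK2WeightControl.twoSided_finite_control`; **`finite_quotSMulTop_invariants_restrict`**
— along `φ : G_{K_v} → Γ_K` with `κ(φ(G_{K_v})) ⊇ p^s ℤ_p` (`v` finitely decomposed): literally its `hfin` at `v ∈ L₀` (the LOCAL defect).

INPUT SHAPES (companion file `Theorems/EisensteinPrimesBSDpOnCellCTelescopeK2GlobalDefectInputs.lean`, independent of this one):
the finite set `{a ∈ A[c] : a fixed by ker κ}` from an equivariant quasi-isomorphism `θ₀ : A[c] → P` with finite kernel (the
(fd₀)/(fd_k) maps of N1 `stub_branchLattice`), and `htor` at the member weights `c = X − C x_k` from N1's (tor) alone.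

HONEST FRAMING: module algebra and the `H⁰`-Shapiro transport on the constructed co-induced model over binders; nothing about any
curve, newform, branch lattice or `L`-function is asserted; that `{a ∈ A₂[X] : ker κ-fixed}` is finite on Cell C (⟸ `E(K_∞)[p^∞]`
finite) is the CONSUMER's input, not proved here; BSD is proved for no pair; no registered stub, crux or summit statement is proved
by this file; closes: none.

References: [Castella2018Erratum] Lemma 2.1 (p. 2: «the kernel of the second arrow is given by `H⁰(K_𝔭, M_g)/ϖ^m H⁰(K_𝔭, M_g)`»;
here the GLOBAL arrow and a finite, not zero, defect); [SkinnerUrban2014] §3.1.3, Prop. 3.2.3 (Shapiro in the co-induced model);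
[JetchevSkinnerWan2017] Lemma 3.4.1 (arXiv:1512.06894 p. 14: finite-defect control); [GreenbergLNM1716] §4, Lemma 4.4 / proof of
Prop. 4.10 («`E(K_∞)_{tors}` … finite»; the count `#coker ≤ #ker` on torsion modules).
-/

noncomputable section

-- D-0017: single-problem summit, the namespace repeats the problem name by design.
set_option linter.dupNamespace false
set_option autoImplicit false

open scoped Pointwise
open Literature.NumberTheory.GaloisRepresentations Literature.NumberTheory.EllipticCurves
  Literature.NumberTheory.EllipticCurves.BigRepModule

namespace Summit.BirchSwinnertonDyer.BirchSwinnertonDyer.Theorems.TelescopeK2GlobalDefectFinite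

/-! ## §1 Pure algebra: `x`-power torsion with finite `x`-torsion has finite `x`-cotorsion -/

section Algebra

universe u v

variable {R : Type u} [CommRing R] (x : R)

/-- **A module killed by `x ^ n` with finite `x`-torsion is finite** (induction on `n` along
`0 → M[x] → M → x·M → 0`: `x·M` is killed by `x^{n-1}` and `(x·M)[x] ⊆ M[x]`).
[cite: GreenbergLNM1716, §4, Lemma 4.4 and proof of Prop. 4.10 (counting torsion modules)] [folklore] -/
theorem finite_of_pow_smul_eq_zero (n : ℕ) :
    ∀ {M : Type v} [AddCommGroup M] [Module R M],
      (∀ m : M, x ^ n • m = 0) → Finite (Submodule.torsionBy R M x) → Finite M := by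
  induction n with
  | zero =>
    intro M _ _ hM _
    haveI : Subsingleton M := ⟨fun a b => by
      have ha := hM a; have hb := hM b; rw [pow_zero, one_smul] at ha hb; rw [ha, hb]⟩
    infer_instance
  | succ n ih =>
    intro M _ _ hM hfin
    let f : M →ₗ[R] M := x • (LinearMap.id : M →ₗ[R] M)
    have hf : ∀ m : M, f m = x • m := fun m => rfl
    have hker : LinearMap.ker f = Submodule.torsionBy R M x := by
      ext m
      rw [LinearMap.mem_ker, hf, Submodule.mem_torsionBy_iff]
    have hR : ∀ m : LinearMap.range f, x ^ n • m = 0 := by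
      rintro ⟨_, m, rfl⟩
      apply Subtype.ext
      change x ^ n • f m = 0
      rw [hf, smul_smul, ← pow_succ]
      exact hM m
    have hRfin : Finite (Submodule.torsionBy R (LinearMap.range f) x) := by
      haveI := hfin
      refine Finite.of_injective
        (fun m : Submodule.torsionBy R (LinearMap.range f) x =>
          (⟨((m : LinearMap.range f) : M), by
            have hm := m.2
            rw [Submodule.mem_torsionBy_iff] at hm ⊢
            exact congrArg Subtype.val hm⟩ : Submodule.torsionBy R M x)) ?_
      intro a b h
      apply Subtype.ext
      apply Subtype.ext
      exact congrArg (fun z : Submodule.torsionBy R M x => (z : M)) h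
    haveI : Finite (LinearMap.range f) := ih hR hRfin
    haveI : Finite (M ⧸ LinearMap.ker f) := Finite.of_equiv _ f.quotKerEquivRange.toEquiv.symm
    haveI : Finite (LinearMap.ker f) := by rw [hker]; exact hfin
    haveI : Finite (M ⧸ (LinearMap.ker f).toAddSubgroup) := ‹Finite (M ⧸ LinearMap.ker f)›
    haveI : Finite (LinearMap.ker f).toAddSubgroup := ‹Finite (LinearMap.ker f)›
    exact Finite.of_addSubgroup_quotient (LinearMap.ker f).toAddSubgroup

variable {M : Type v} [AddCommGroup M] [Module R M]

/-- **`#(M ⧸ xM) = #M[x]` for a FINITE module** (kernel and cokernel of `m ↦ x • m` have the same size).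
[cite: GreenbergLNM1716, §4, proof of Lemma 4.4 (Herbrand-quotient count)] [folklore] -/
theorem natCard_quotSMulTop_eq_natCard_torsionBy [Finite M] :
    Nat.card (QuotSMulTop x M) = Nat.card (Submodule.torsionBy R M x) := by
  have h := Literature.Algebra.Module.natCard_quotient_range_eq_natCard_ker
    (x • (LinearMap.id : M →ₗ[R] M))
  have hrange : LinearMap.range (x • (LinearMap.id : M →ₗ[R] M)) = x • (⊤ : Submodule R M) := by
    ext m
    rw [LinearMap.mem_range, Submodule.mem_smul_pointwise_iff_exists]
    constructor
    · rintro ⟨w, rfl⟩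
      exact ⟨w, Submodule.mem_top, rfl⟩
    · rintro ⟨w, -, rfl⟩
      exact ⟨w, rfl⟩
  have hker : LinearMap.ker (x • (LinearMap.id : M →ₗ[R] M)) = Submodule.torsionBy R M x := by
    ext m
    rw [LinearMap.mem_ker, Submodule.mem_torsionBy_iff]
    rfl
  rw [hrange, hker] at h
  exact h

/-- A finitely generated submodule all of whose generators are `x`-power torsion is killed by one power of `x`.
[folklore] -/
theorem exists_pow_smul_eq_zero_of_span (S : Finset M) (htor : ∀ m ∈ S, ∃ n : ℕ, x ^ n • m = 0) :
    ∃ n : ℕ, ∀ m ∈ Submodule.span R (S : Set M), x ^ n • m = 0 := by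
  classical
  choose! nS hnS using htor
  refine ⟨S.sup nS, fun m hm => ?_⟩
  induction hm using Submodule.span_induction with
  | mem m hm =>
    obtain ⟨d, hd⟩ := Nat.exists_eq_add_of_le (Finset.le_sup (f := nS) (Finset.mem_coe.mp hm))
    rw [hd, pow_add, mul_comm, mul_smul, hnS m (Finset.mem_coe.mp hm), smul_zero]
  | zero => rw [smul_zero]
  | add a b _ _ ha hb => rw [smul_add, ha, hb, add_zero]
  | smul r a _ ha => rw [smul_comm, ha, smul_zero]

/-- Every finite family of classes in `M ⧸ xM` has at most `#M[x]` members, when `M` is `x`-power torsion with finite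
`x`-torsion. [cite: GreenbergLNM1716, §4, proof of Lemma 4.4 (Herbrand-quotient count)] [folklore] -/
theorem finsetCard_quotSMulTop_le (htor : ∀ m : M, ∃ n : ℕ, x ^ n • m = 0)
    [hfin : Finite (Submodule.torsionBy R M x)] (S : Finset (QuotSMulTop x M)) :
    S.card ≤ Nat.card (Submodule.torsionBy R M x) := by
  classical
  -- representatives and the finitely generated submodule they span
  choose rep hrep using fun q : QuotSMulTop x M => Submodule.Quotient.mk_surjective (p := x • ⊤) q
  let N : Submodule R M := Submodule.span R ((S.image rep : Finset M) : Set M)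
  obtain ⟨n, hn⟩ := exists_pow_smul_eq_zero_of_span x (S.image rep) (fun m _ => htor m)
  -- `N` is finite
  have hNtor : Finite (Submodule.torsionBy R N x) := by
    refine Finite.of_injective
      (fun m : Submodule.torsionBy R N x =>
        (⟨((m : N) : M), by
          have hm := m.2
          rw [Submodule.mem_torsionBy_iff] at hm ⊢
          exact congrArg Subtype.val hm⟩ : Submodule.torsionBy R M x)) ?_
    intro a b h
    apply Subtype.ext
    apply Subtype.ext
    exact congrArg (fun z : Submodule.torsionBy R M x => (z : M)) h
  haveI : Finite N := finite_of_pow_smul_eq_zero x n (M := N) (fun m => Subtype.ext (hn m m.2)) hNtor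
  haveI : Finite (QuotSMulTop x N) :=
    Finite.of_surjective (Submodule.Quotient.mk (p := x • (⊤ : Submodule R N)))
      (Submodule.Quotient.mk_surjective _)
  haveI : Fintype (QuotSMulTop x N) := Fintype.ofFinite _
  -- every class of `S` is the image of a class of `N ⧸ xN`
  let ι : QuotSMulTop x N →ₗ[R] QuotSMulTop x M := QuotSMulTop.map x N.subtype
  have hS : S ⊆ Finset.univ.image ι := by
    intro q hq
    have hmem : rep q ∈ N := Submodule.subset_span (by
      rw [Finset.mem_coe, Finset.mem_image]
      exact ⟨q, hq, rfl⟩)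
    rw [Finset.mem_image]
    refine ⟨Submodule.Quotient.mk ⟨rep q, hmem⟩, Finset.mem_univ _, ?_⟩
    rw [QuotSMulTop.map_apply_mk, Submodule.subtype_apply, hrep]
  calc S.card ≤ (Finset.univ.image ι).card := Finset.card_le_card hS
    _ ≤ (Finset.univ : Finset (QuotSMulTop x N)).card := Finset.card_image_le
    _ = Nat.card (QuotSMulTop x N) := by rw [Finset.card_univ, Nat.card_eq_fintype_card]
    _ = Nat.card (Submodule.torsionBy R N x) := natCard_quotSMulTop_eq_natCard_torsionBy x
    _ ≤ Nat.card (Submodule.torsionBy R M x) := by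
      refine Nat.card_le_card_of_injective
        (fun m : Submodule.torsionBy R N x =>
          (⟨((m : N) : M), by
            have hm := m.2
            rw [Submodule.mem_torsionBy_iff] at hm ⊢
            exact congrArg Subtype.val hm⟩ : Submodule.torsionBy R M x)) ?_
      intro a b h
      apply Subtype.ext
      apply Subtype.ext
      exact congrArg (fun z : Submodule.torsionBy R M x => (z : M)) h

/-- **An `x`-power-torsion module with finite `x`-torsion has finite `x`-cotorsion.**
[cite: GreenbergLNM1716, §4, Lemma 4.4 and proof of Prop. 4.10] [folklore] -/
theorem finite_quotSMulTop_of_isPowTorsion (htor : ∀ m : M, ∃ n : ℕ, x ^ n • m = 0)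
    [Finite (Submodule.torsionBy R M x)] : Finite (QuotSMulTop x M) := by
  by_contra h; rw [not_finite_iff_infinite] at h
  obtain ⟨S, hS⟩ := Infinite.exists_subset_card_eq (QuotSMulTop x M)
    (Nat.card (Submodule.torsionBy R M x) + 1)
  have := finsetCard_quotSMulTop_le x htor S
  omega

/-- **`#(M ⧸ xM) ≤ #M[x]`** for an `x`-power-torsion module with finite `x`-torsion.
[cite: GreenbergLNM1716, §4, Lemma 4.4 and proof of Prop. 4.10] [folklore] -/
theorem natCard_quotSMulTop_le_of_isPowTorsion (htor : ∀ m : M, ∃ n : ℕ, x ^ n • m = 0)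
    [Finite (Submodule.torsionBy R M x)] :
    Nat.card (QuotSMulTop x M) ≤ Nat.card (Submodule.torsionBy R M x) := by
  classical
  haveI := finite_quotSMulTop_of_isPowTorsion x htor
  haveI : Fintype (QuotSMulTop x M) := Fintype.ofFinite _
  rw [Nat.card_eq_fintype_card, ← Finset.card_univ]
  exact finsetCard_quotSMulTop_le x htor _

end Algebra

/-! ## §2 The co-induced module: `(C c)`-power torsion, and the `C c`-torsion of the invariants -/

section BigRep

variable {𝒪 : Type*} [CommRing 𝒪] [TopologicalSpace 𝒪] {p : ℕ} [Fact p.Prime]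
  {A : Type*} [AddCommGroup A] [Module 𝒪 A] [TopologicalSpace A] [DiscreteTopology A]
  {G : Type*} [Group G] [TopologicalSpace G] [ContinuousMul G]
  (κ : G →ₜ* Multiplicative ℤ_[p]) (ρ : ContinuousRep G 𝒪 A) [TopologicalSpace (PowerSeries 𝒪)]

omit [TopologicalSpace 𝒪] [TopologicalSpace A] [DiscreteTopology A] [TopologicalSpace (PowerSeries 𝒪)] in
/-- A smooth function of level `n` is read off at `x.appr n < p^n`. [cite: SkinnerUrban2014, §3.1.3 (Λ^* = lim Maps(Γ/Γ^{pⁿ}, ·))] -/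
theorem apply_eq_apply_appr {n : ℕ} {Φ : BigRepModule 𝒪 p A} (hΦ : IsSmoothOfLevel p A n Φ) (x : ℤ_[p]) :
    Φ x = Φ ((x.appr n : ℕ) : ℤ_[p]) := hΦ _ _ (PadicInt.appr_spec n x)

omit [TopologicalSpace 𝒪] [TopologicalSpace A] [DiscreteTopology A] [TopologicalSpace (PowerSeries 𝒪)] in
/-- **Every `Φ ∈ A ⊗ Λ^*` is `(C c)`-power torsion when the `p`-primary elements of `A` are `c`-power torsion** (`Φ` has
finitely many values, all `p`-primary). [cite: SkinnerUrban2014, §3.1.3 and proof of Prop. 3.2.3] -/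
theorem exists_C_pow_smul_eq_zero (c : 𝒪)
    (htor : ∀ a : A, (∃ k : ℕ, p ^ k • a = 0) → ∃ n : ℕ, c ^ n • a = 0) (Φ : BigRepModule 𝒪 p A) :
    ∃ n : ℕ, (PowerSeries.C c : PowerSeries 𝒪) ^ n • Φ = 0 := by
  classical
  obtain ⟨k, hk⟩ := Φ.exists_level
  obtain ⟨t, ht⟩ := Φ.exists_torsion
  have hval : ∀ i : ℕ, ∃ n : ℕ, c ^ n • Φ (i : ℤ_[p]) = 0 := fun i => htor _ ⟨t, ht _⟩
  choose nA hnA using hval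
  refine ⟨(Finset.range (p ^ k)).sup nA, ?_⟩
  rw [← map_pow, C_smul]
  ext y
  rw [BigRepModule.smul_apply, BigRepModule.zero_apply, apply_eq_apply_appr hk y]
  have hi : y.appr k ∈ Finset.range (p ^ k) := Finset.mem_range.mpr (PadicInt.appr_lt y k)
  obtain ⟨d, hd⟩ := Nat.exists_eq_add_of_le (Finset.le_sup (f := nA) hi)
  rw [hd, pow_add, mul_comm, mul_smul, hnA, smul_zero]

variable [ContinuousSMul (PowerSeries 𝒪) (BigRepModule 𝒪 p A)]

/-- **`Φ ↦ (Φ(i))_{i<p^s}` embeds `M^G[C c]` into `{a ∈ A[c] : a fixed by ker κ}^{p^s}` when `κ(G) ⊇ p^s ℤ_p`** (an invariant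
function is determined by `p^s` values: tree `BigRepLocalInvariants.eq_of_forall_apply_natCast_eq`; its values are `ker κ`-fixed:
`apply_eq_self_of_invariant`). `s = 0` globally (`κ` onto); `p^s` = number of primes of `K_∞` above a finitely decomposed `v`
for a decomposition group. [cite: SkinnerUrban2014, Prop. 3.2.3 (Shapiro, co-induced model)] [cite: Castella2018Erratum, Lemma 2.1] -/
theorem exists_injective_torsionBy_invariants (c : 𝒪) {s : ℕ}
    (hsurj : ∀ y : ℤ_[p], ∃ g : G, (κ g).toAdd = (p : ℤ_[p]) ^ s * y) :
    ∃ ev : Submodule.torsionBy (PowerSeries 𝒪) (↥(bigRep κ ρ).toTopRep.ρ.invariants) (PowerSeries.C c : PowerSeries 𝒪) →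
      (Fin (p ^ s) → {a : A | c • a = 0 ∧ ∀ g : G, κ g = 1 → ρ g a = a}), Function.Injective ev := by
  have hinv : ∀ Φ : Submodule.torsionBy (PowerSeries 𝒪) (↥(bigRep κ ρ).toTopRep.ρ.invariants)
      (PowerSeries.C c : PowerSeries 𝒪), ∀ g : G, bigRep κ ρ g ((Φ : ↥(bigRep κ ρ).toTopRep.ρ.invariants) :
        BigRepModule 𝒪 p A) = ((Φ : ↥(bigRep κ ρ).toTopRep.ρ.invariants) : BigRepModule 𝒪 p A) :=
    fun Φ => (BigRepLocalInvariants.mem_invariants_iff κ ρ _).1 (Φ : ↥(bigRep κ ρ).toTopRep.ρ.invariants).2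
  refine ⟨fun Φ i => ⟨((Φ : ↥(bigRep κ ρ).toTopRep.ρ.invariants) : BigRepModule 𝒪 p A) (i : ℕ), ?_, fun g hg =>
      BigRepLocalInvariants.apply_eq_self_of_invariant κ ρ (hinv Φ) hg _⟩, ?_⟩
  · -- `c • Φ(i) = ((C c) • Φ)(i) = 0`
    have h := Φ.2
    rw [Submodule.mem_torsionBy_iff] at h
    have h' := congrArg (fun Ψ : ↥(bigRep κ ρ).toTopRep.ρ.invariants => (Ψ : BigRepModule 𝒪 p A) (i : ℕ)) h
    simpa only [Submodule.coe_smul, C_smul, BigRepModule.smul_apply, Submodule.coe_zero,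
      BigRepModule.zero_apply] using h'
  · intro Φ Ψ h
    apply Subtype.ext
    apply Subtype.ext
    refine BigRepLocalInvariants.eq_of_forall_apply_natCast_eq κ ρ hsurj (hinv Φ) (hinv Ψ) fun i hi => ?_
    exact congrArg (fun z : {a : A | c • a = 0 ∧ ∀ g : G, κ g = 1 → ρ g a = a} => (z : A)) (congrFun h ⟨i, hi⟩)

/-- **`M^G[C c]` is finite when `{a ∈ A[c] : a fixed by ker κ}` is and `κ(G) ⊇ p^s ℤ_p`.**
[cite: SkinnerUrban2014, Prop. 3.2.3 (Shapiro, co-induced model)] [cite: Castella2018Erratum, Lemma 2.1 (the defect H⁰/ϖ^m)] -/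
theorem finite_torsionBy_invariants (c : 𝒪) {s : ℕ} (hsurj : ∀ y : ℤ_[p], ∃ g : G, (κ g).toAdd = (p : ℤ_[p]) ^ s * y)
    (hfin : Set.Finite {a : A | c • a = 0 ∧ ∀ g : G, κ g = 1 → ρ g a = a}) :
    Finite (Submodule.torsionBy (PowerSeries 𝒪) (↥(bigRep κ ρ).toTopRep.ρ.invariants)
      (PowerSeries.C c : PowerSeries 𝒪)) := by
  haveI := hfin.to_subtype
  obtain ⟨ev, hev⟩ := exists_injective_torsionBy_invariants κ ρ c hsurj
  exact Finite.of_injective ev hev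

/-- Every invariant is `(C c)`-power torsion when the `p`-primary elements of `A` are. [folklore] -/
theorem exists_C_pow_smul_invariants_eq_zero (c : 𝒪)
    (htor : ∀ a : A, (∃ k : ℕ, p ^ k • a = 0) → ∃ n : ℕ, c ^ n • a = 0)
    (Φ : ↥(bigRep κ ρ).toTopRep.ρ.invariants) :
    ∃ n : ℕ, (PowerSeries.C c : PowerSeries 𝒪) ^ n • Φ = 0 := by
  obtain ⟨n, hn⟩ := exists_C_pow_smul_eq_zero c htor (Φ : BigRepModule 𝒪 p A)
  exact ⟨n, Subtype.ext hn⟩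

/-- **THE BINDER: `M^G ⧸ (C c)·M^G` is FINITE** for `M = A ⊗ Λ^*(Ψ⁻¹) = bigRep κ ρ` with `κ(G) ⊇ p^s ℤ_p`, as soon as the
`p`-primary elements of `A` are `c`-power torsion and `{a ∈ A[c] : a fixed by ker κ}` is finite (on Cell C at `c = X`: `A₂` is
`X`-power torsion by (tor) and `A₂[X](K_∞) ≈ E(K_∞)[p^∞]` is finite). `G = Γ_K`, `s = 0`: the hypothesis `hglob`/`hfin` of the
tree's `TelescopeK2WeightControl.finite_ker_torsionInclH1_of_finite_quot` (`r = C c`) — the global control defect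
`ker (H¹(G, M[r]) → H¹(G, M))` is finite; `G = G_{K_v}` finitely decomposed: the `hfin` of `twoSided_finite_control` at `v ∈ L₀`.
[cite: Castella2018Erratum, Lemma 2.1 (p. 2)] [cite: JetchevSkinnerWan2017, Lemma 3.4.1 (arXiv:1512.06894 p. 14)]
[cite: SkinnerUrban2014, Prop. 3.2.3] -/
theorem finite_quotSMulTop_invariants (c : 𝒪) {s : ℕ} (hsurj : ∀ y : ℤ_[p], ∃ g : G, (κ g).toAdd = (p : ℤ_[p]) ^ s * y)
    (htor : ∀ a : A, (∃ k : ℕ, p ^ k • a = 0) → ∃ n : ℕ, c ^ n • a = 0)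
    (hfin : Set.Finite {a : A | c • a = 0 ∧ ∀ g : G, κ g = 1 → ρ g a = a}) :
    Finite (↥(bigRep κ ρ).toTopRep.ρ.invariants ⧸
      (PowerSeries.C c : PowerSeries 𝒪) • (⊤ : Submodule (PowerSeries 𝒪) ↥(bigRep κ ρ).toTopRep.ρ.invariants)) := by
  haveI := finite_torsionBy_invariants κ ρ c hsurj hfin
  exact finite_quotSMulTop_of_isPowTorsion (PowerSeries.C c : PowerSeries 𝒪)
    (exists_C_pow_smul_invariants_eq_zero κ ρ c htor)

/-- **`#(M^G ⧸ (C c)·M^G) ≤ #{a ∈ A[c] : a fixed by ker κ} ^ (p^s)`** (same hypotheses). [cite: Castella2018Erratum, Lemma 2.1 (p. 2)]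
[cite: GreenbergLNM1716, §4, Lemma 4.4] -/
theorem natCard_quotSMulTop_invariants_le (c : 𝒪) {s : ℕ}
    (hsurj : ∀ y : ℤ_[p], ∃ g : G, (κ g).toAdd = (p : ℤ_[p]) ^ s * y)
    (htor : ∀ a : A, (∃ k : ℕ, p ^ k • a = 0) → ∃ n : ℕ, c ^ n • a = 0)
    (hfin : Set.Finite {a : A | c • a = 0 ∧ ∀ g : G, κ g = 1 → ρ g a = a}) :
    Nat.card (↥(bigRep κ ρ).toTopRep.ρ.invariants ⧸
      (PowerSeries.C c : PowerSeries 𝒪) • (⊤ : Submodule (PowerSeries 𝒪) ↥(bigRep κ ρ).toTopRep.ρ.invariants)) ≤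
      Nat.card {a : A | c • a = 0 ∧ ∀ g : G, κ g = 1 → ρ g a = a} ^ (p ^ s) := by
  haveI := finite_torsionBy_invariants κ ρ c hsurj hfin
  haveI := hfin.to_subtype
  obtain ⟨ev, hev⟩ := exists_injective_torsionBy_invariants κ ρ c hsurj
  refine le_trans (natCard_quotSMulTop_le_of_isPowTorsion (PowerSeries.C c : PowerSeries 𝒪)
    (exists_C_pow_smul_invariants_eq_zero κ ρ c htor)) ?_
  have h := Nat.card_le_card_of_injective ev hev
  rwa [Nat.card_pi, Finset.prod_const, Finset.card_univ, Fintype.card_fin] at h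

variable {H : Type*} [Group H] [TopologicalSpace H] [ContinuousMul H]

/-- **The LOCAL form** along `φ : H → G` (`G_{K_v} → Γ_K`, `κ(φ(H)) ⊇ p^s ℤ_p`: `v` finitely decomposed in `K_∞`):
`(M|_H)^H ⧸ (C c)·(M|_H)^H` is finite from the finiteness of the `ker (κ ∘ φ)`-fixed `c`-torsion of `A` — literally the `hfin`
of `TelescopeK2WeightControl.twoSided_finite_control` at `v ∈ L₀`, `r = C c` (tree `bigRep_restrict`).
[cite: Castella2018Erratum, Lemma 2.1 (p. 2: «`H⁰(K_𝔭, M_g)/ϖ^m H⁰(K_𝔭, M_g)`»)] [cite: SkinnerUrban2014, Prop. 3.2.3] -/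
theorem finite_quotSMulTop_invariants_restrict (c : 𝒪) (φ : H →ₜ* G) {s : ℕ}
    (hsurj : ∀ y : ℤ_[p], ∃ h : H, (κ (φ h)).toAdd = (p : ℤ_[p]) ^ s * y)
    (htor : ∀ a : A, (∃ k : ℕ, p ^ k • a = 0) → ∃ n : ℕ, c ^ n • a = 0)
    (hfin : Set.Finite {a : A | c • a = 0 ∧ ∀ h : H, κ (φ h) = 1 → ρ (φ h) a = a}) :
    Finite (QuotSMulTop (PowerSeries.C c : PowerSeries 𝒪) ↥(((bigRep (p := p) κ ρ).restrict φ).toTopRep).ρ.invariants) := by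
  rw [bigRep_restrict]
  exact finite_quotSMulTop_invariants (κ.comp φ) (ρ.restrict φ) c hsurj htor hfin

end BigRep

/-! ## §2' The anticyclotomic specialisation (`κ : ZpExtension K p` is onto `ℤ_p` by definition) -/

section Anticyclotomic

universe u

variable {K : Type u} [Field K] {p : ℕ} [Fact p.Prime]
  {𝒪 : Type*} [CommRing 𝒪] [TopologicalSpace 𝒪]
  {A : Type*} [AddCommGroup A] [Module 𝒪 A] [TopologicalSpace A] [DiscreteTopology A]
  [TopologicalSpace (PowerSeries 𝒪)] [ContinuousSMul (PowerSeries 𝒪) (BigRepModule 𝒪 p A)]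

/-- **`hglob` for `M₂ = AnticyclotomicBigGaloisRep κ ρ`**: `M₂^{Γ_K} ⧸ (C c)·M₂^{Γ_K}` is FINITE as soon as the `p`-primary
elements of `A` are `c`-power torsion and the `Gal(K̄/K_∞) = ker κ`-fixed `c`-torsion of `A` is finite — literally the
hypothesis `hglob` of `TelescopeK2WeightControl.twoSided_finite_control` / `hfin` of `finite_ker_torsionInclH1_of_finite_quot`
at `r = C c` (weight two: `c = X`; member `k`: `c = X − C x_k`). [cite: Castella2018Erratum, Lemma 2.1 (p. 2)]
[cite: JetchevSkinnerWan2017, Lemma 3.4.1 (arXiv:1512.06894 p. 14)] [cite: SkinnerUrban2014, Prop. 3.2.3] -/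
theorem finite_quotSMulTop_invariants_anticyclotomic (κ : ZpExtension K p)
    (ρ : ContinuousRep (Field.absoluteGaloisGroup K) 𝒪 A) (c : 𝒪)
    (htor : ∀ a : A, (∃ k : ℕ, p ^ k • a = 0) → ∃ n : ℕ, c ^ n • a = 0)
    (hfin : Set.Finite {a : A | c • a = 0 ∧ ∀ g : Field.absoluteGaloisGroup K, κ g = 1 → ρ g a = a}) :
    Finite (↥(AnticyclotomicBigGaloisRep κ ρ).toTopRep.ρ.invariants ⧸
      (PowerSeries.C c : PowerSeries 𝒪) •
        (⊤ : Submodule (PowerSeries 𝒪) ↥(AnticyclotomicBigGaloisRep κ ρ).toTopRep.ρ.invariants)) :=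
  finite_quotSMulTop_invariants κ.toContinuousMonoidHom ρ c (s := 0)
    (fun y => by
      obtain ⟨g, hg⟩ := κ.surjective (Multiplicative.ofAdd y)
      exact ⟨g, by rw [hg, pow_zero, one_mul]; rfl⟩)
    htor hfin

end Anticyclotomic

end Summit.BirchSwinnertonDyer.BirchSwinnertonDyer.Theorems.TelescopeK2GlobalDefectFinite

end
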